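import Mathlib
import HarnessLib
import Summits.ValiantsHypothesis.ValiantsHypothesis.Theorems.MonotoneRestorationOrbitRestorationLinearVolumeQPImpliesVH
import Summits.ValiantsHypothesis.ValiantsHypothesis.Theorems.MonotoneRestorationOrbitRestorationLinearVolumeQPDiNarrowSpanTight

/-!
# The tight one-sorted stubs of R1 are VH-strength: `LvDiNarrowSpan` ⇒ VP ≠ VNP, `LvDiNarrow` ⇒ VP ≠ VNP

Route MonotoneRestoration, aside R1 = `OrbitRestorationLinearVolumeQP` (stmt-ValiantsHypothesis-18294).  The crux is
EQUIVALENT to each of its one-sorted re-statements — `LvDiNarrow` (expression currency,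
`OrbitRestorationLinearVolumeQPDiNarrow.orbitRestorationLinearVolumeQP_iff_lvDiNarrow`) and `LvDiNarrowSpan` (span
currency, `OrbitRestorationLinearVolumeQPDiNarrowSpan.orbitRestorationLinearVolumeQP_iff_lvDiNarrowSpan`, this hand) —
and R1 decides the summit (`valiantsHypothesis_of_orbitRestorationLinearVolumeQP`, unconditional).  For the planner's
strength records (BC5) of a re-lined skeleton:

* `valiantsHypothesis_of_lvDiNarrowSpan` — if every `VP` family of R1's class lies on every level in the `ℂ`-span of
  the one-sorted homomorphism polynomials of directed looped patterns of treewidth `≤ (log₂ n + c)^c`, then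
  `VP ≠ VNP` over `ℂ`;
* `valiantsHypothesis_of_lvDiNarrow` — the same from the expression form (eventually the closed polynomial of a
  one-sorted expression with `n^k ≤ 2^{(log₂ n + c)^c}` labels).

Honest framing: two-line compositions; nothing is proved about the stubs, R1, the crux or VP ≠ VNP.
-/

noncomputable section

-- `Summit.ValiantsHypothesis.ValiantsHypothesis.…` is the tree's single-conjunct layout (Sub = Summit).
set_option linter.dupNamespace false

namespace Summit.ValiantsHypothesis.ValiantsHypothesis.Theorems

namespace OrbitRestorationLinearVolumeQPVHStrength

open Summit.ValiantsHypothesis.ValiantsHypothesis.Theses.MonotoneRestoration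
open Literature.Computability.AlgebraicComplexity MvPolynomial

/-- **`LvDiNarrowSpan` ⇒ VP ≠ VNP**: the tight one-sorted span-currency form of R1 implies Valiant's hypothesis
over `ℂ`. [cite: DwivediPagoSeppelt2026, Outlook Q3; DawarWilsenach2025, Thm 7.2] -/
theorem valiantsHypothesis_of_lvDiNarrowSpan
    (h : ∀ f : (n : ℕ) → MvPolynomial (Fin n × Fin n) ℂ, IsVPFamily f →
      (∃ (c : ℕ) (m : ℕ → ℕ) (a b : (n : ℕ) → Fin (m n) → ℕ)
          (E : (n : ℕ) → (i : Fin (m n)) → Multiset (Fin (a n i) × Fin (b n i)))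
          (α : (n : ℕ) → Fin (m n) → ℂ),
        (∀ n, m n ≤ (n + 2) ^ c) ∧ (∀ n i, a n i + b n i ≤ c * (n + 1)) ∧
          ∀ n, f n = ∑ i : Fin (m n), C (α n i) * homPoly (E n i) n ℂ) →
      ∃ c : ℕ, ∀ n : ℕ, f n ∈ Submodule.span ℂ {q : MvPolynomial (Fin n × Fin n) ℂ |
        ∃ (a : ℕ) (D : Multiset (Fin a × Fin a)),
          Literature.Combinatorics.SimpleGraph.treewidth
              (SimpleGraph.fromRel fun u v : Fin a => ∃ e ∈ D, u = e.1 ∧ v = e.2) ≤ (Nat.log 2 n + c) ^ c ∧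
            q = diHomPoly D n ℂ}) :
    ValiantsHypothesis :=
  valiantsHypothesis_of_orbitRestorationLinearVolumeQP
    (OrbitRestorationLinearVolumeQPDiNarrowSpan.orbitRestorationLinearVolumeQP_of_lvDiNarrowSpan h)

/-- **`LvDiNarrow` ⇒ VP ≠ VNP**: the tight one-sorted expression-currency form of R1 implies Valiant's hypothesis
over `ℂ`. [cite: DwivediPagoSeppelt2026, Outlook Q3; DawarWilsenach2025, Thm 7.2] -/
theorem valiantsHypothesis_of_lvDiNarrow
    (h : ∀ f : (n : ℕ) → MvPolynomial (Fin n × Fin n) ℂ, IsVPFamily f →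
      (∃ (c : ℕ) (m : ℕ → ℕ) (a b : (n : ℕ) → Fin (m n) → ℕ)
          (E : (n : ℕ) → (i : Fin (m n)) → Multiset (Fin (a n i) × Fin (b n i)))
          (α : (n : ℕ) → Fin (m n) → ℂ),
        (∀ n, m n ≤ (n + 2) ^ c) ∧ (∀ n i, a n i + b n i ≤ c * (n + 1)) ∧
          ∀ n, f n = ∑ i : Fin (m n), C (α n i) * homPoly (E n i) n ℂ) →
      ∃ c n₀ : ℕ, ∀ n : ℕ, n₀ ≤ n → ∃ (k : ℕ) (e : DiPatternExpr ℂ k),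
        n ^ k ≤ 2 ^ ((Nat.log 2 n + c) ^ c) ∧ e.close n = f n) :
    ValiantsHypothesis :=
  valiantsHypothesis_of_orbitRestorationLinearVolumeQP
    (OrbitRestorationLinearVolumeQPDiNarrow.orbitRestorationLinearVolumeQP_of_lvDiNarrow h)

end OrbitRestorationLinearVolumeQPVHStrength

end Summit.ValiantsHypothesis.ValiantsHypothesis.Theorems

end
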